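import Literature.NumberTheory.EllipticCurves.NewformsCoeffFieldProofs
import Literature.NumberTheory.EllipticCurves.ModularSymbolsEichlerShimuraHoldsProofs
import Literature.NumberTheory.EllipticCurves.ModularCurveSturmProofs
import HarnessLib

/-!
# Shimura's Hecke-stable lattice (3.5.20) on `S_k(Γ₀(N))`: the weight-`2` case, the trivial
# weights, and the reduction to a Hecke-stable dual lattice (`NewformsCoeffField`, continued)

`Literature.NumberTheory.EllipticCurves.NewformsCoeffFieldProofs` states Shimura's (3.5.20)
(Shimura 1971, p. 84, proved in §8.4, p. 241) for `Γ' = Γ₀(N)` and the operators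
`T_p = [Γ₀(N) diag(1, p) Γ₀(N)]` as the named fact `gamma0_exists_heckeStableLattice N k`: for
`k ≥ 2` there is an `ℝ`-basis `b` of `S_k(Γ₀(N))` with `T_p(bᵢ) ∈ ∑ⱼ ℤ bⱼ` for all primes `p`.
Shimura's proof (§8.4, last paragraph of p. 241): the real Eichler–Shimura isomorphism
`μ : H¹_P(Γ, D_ℝ) ≅ S_{n+2}(Γ)` (Thm. 8.4, using the dimension count (8.2.23)), its Hecke
equivariance (Prop. 8.5) and the lattice `j(H¹_P(Γ, D)) ⊆ H¹_P(Γ, D_ℝ)`, `D = ℤ^{n+1}` (Prop. 8.6)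
give the lattice `L = μ(j(H¹_P(Γ, D)))`.

This file proves:

* `exists_basis_of_dual_basis` (linear algebra, the step "`L = μ(j(H¹_P(Γ, D)))` is a lattice
  stable under `(ΓαΓ)_{n+2}`" read through the duality `S ≅ (S^∧)^∧`): if the complex dual `V^∧`
  of a finite-dimensional complex vector space `V` has an `ℝ`-basis `b'` whose `ℤ`-span is stable
  under the transposes `T^∨` of a set of endomorphisms `T`, then `V` has an `ℝ`-basis `b` — the
  dual basis for the pairing `(v, φ) ↦ re φ(v)`, `re (b'ⱼ bᵢ) = δᵢⱼ` — whose `ℤ`-span is stable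
  under the `T` (the matrix of `T` on `b` is the transpose of the integral matrix of `T^∨` on
  `b'`);
* `gamma0_exists_heckeStableLattice_of_dual_basis` (all weights): (3.5.20) for `(N, k)` follows
  from an `ℝ`-basis of `S_k(Γ₀(N))^∧` with `T_p^∨`-stable `ℤ`-span — the form in which the
  weight-`k` Eichler–Shimura theory delivers it (Shimura Prop. 8.6 with Thm. 8.4, Prop. 8.5);
* `gamma0_exists_heckeStableLattice_two` (**weight `2`, unconditionally, every `N ≥ 1`**): the
  period homology `H₁(X₀(N), ℤ) ⊆ S₂(Γ₀(N))^∧` is the `ℤ`-span of an `ℝ`-basis of the dual space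
  (`periodHomology_eq_span_basis_holds`, the tree's Eichler–Shimura theorem for `X₀(N)`:
  Manin's presentation of `H₁(X₀(N))`, `dim S₂(Γ₀(N)) = g(X₀(N))`, and "collinear periods force
  `f = 0`") and is `T_p^∨`-stable (`dualMap_heckeT_mem_periodHomology`, Cremona 1997, §2.4);
* `gamma0_exists_heckeStableLattice_of_lt_two`, `…_of_odd` (`S_k(Γ₀(N)) = 0` for odd `k` since
  `-1 ∈ Γ₀(N)`), and the assembly `gamma0_exists_heckeStableLattice_of_not_even_or_lt_four`:
  **(3.5.20) holds for every `(N, k)` except possibly even `k ≥ 4`**.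

What remains for even `k ≥ 4` is the real Eichler–Shimura isomorphism in weight `k`
(Shimura Thm. 8.4 with (8.2.23): `dim_ℝ H¹_P(Γ₀(N), Symⁿℝ²) = 2 dim_ℂ S_{n+2}(Γ₀(N))` and the
injectivity of `f ↦ Re(class of the period cocycle)`); the tree's `EichlerShimuraPeriods` has the
period functionals, their finite generation, Hecke stability and *complex* separation, but no
rank bound.

## References

* G. Shimura, *Introduction to the arithmetic theory of automorphic functions*, Iwanami Shoten /
  Princeton UP, 1971: Thm. 3.48 and (3.5.20) (pp. 83–84); Thm. 8.4 (p. 234), Prop. 8.5 (p. 238),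
  Prop. 8.6 and the last paragraph of §8.4 (pp. 239–241).
* J. E. Cremona, *Algorithms for modular elliptic curves*, 2nd ed., CUP 1997, §2.4.
* F. Diamond, J. Shurman, *A first course in modular forms*, GTM 228, Springer 2005, §6.1, §6.5.
-/

noncomputable section

open scoped MatrixGroups ModularForm

open CongruenceSubgroup

namespace Literature.NumberTheory.EllipticCurves.ModularForms

/-! ### Linear algebra: a stable lattice from a stable dual lattice -/

section DualBasis

variable {V : Type*} [AddCommGroup V] [Module ℂ V] {ι : Type*}

/-- `re φ(v) = ∑ᵢ φᵢ · re b'ᵢ(v)` for the coordinates `φᵢ` of `φ ∈ V^∧` in an `ℝ`-basis `b'` of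
`V^∧`. [folklore] -/
theorem re_apply_eq_sum_repr_mul [Fintype ι] (b' : Module.Basis ι ℝ (Module.Dual ℂ V))
    (φ : Module.Dual ℂ V) (v : V) : (φ v).re = ∑ i, b'.repr φ i * (b' i v).re := by
  conv_lhs => rw [← b'.sum_repr φ]
  rw [LinearMap.sum_apply, Complex.re_sum]
  refine Finset.sum_congr rfl fun i _ ↦ ?_
  rw [LinearMap.smul_apply, Complex.smul_re, smul_eq_mul]

/-- A vector `v` of a complex vector space with `re φ(v) = 0` for every `φ ∈ V^∧` is zero (apply
the hypothesis to `iφ`). [folklore] -/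
theorem eq_zero_of_forall_re_apply_eq_zero {v : V} (h : ∀ φ : Module.Dual ℂ V, (φ v).re = 0) :
    v = 0 := by
  refine (Module.forall_dual_apply_eq_zero_iff ℂ v).mp fun φ ↦ ?_
  apply Complex.ext
  · simpa using h φ
  · have h1 := h (Complex.I • φ)
    rw [LinearMap.smul_apply, smul_eq_mul, Complex.mul_re, Complex.I_re, Complex.I_im] at h1
    simp only [zero_mul, one_mul, zero_sub, neg_eq_zero] at h1
    simpa using h1

/-- `re φ(r v) = r re φ(v)` for real `r` (the real structure being compatible with the complex
one). [folklore] -/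
theorem re_apply_real_smul [Module ℝ V] [IsScalarTower ℝ ℂ V] (φ : Module.Dual ℂ V) (r : ℝ)
    (v : V) : (φ (r • v)).re = r * (φ v).re := by
  rw [← algebraMap_smul ℂ r v, map_smul, smul_eq_mul, Complex.coe_algebraMap,
    Complex.re_ofReal_mul]

/-- **The dual vectors.** For an `ℝ`-basis `b'` of the complex dual `V^∧` of a finite-dimensional
complex vector space `V` there are `eᵢ ∈ V` with `re φ(eᵢ) = (b'.repr φ) i` for all `φ ∈ V^∧`:
complexify the `i`-th coordinate functional of `b'` (`Module.Dual.extendRCLike`) and pull it back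
along `V ≅ (V^∧)^∧` (`Module.evalEquiv`). [folklore] -/
theorem exists_forall_re_apply_eq_repr [FiniteDimensional ℂ V]
    (b' : Module.Basis ι ℝ (Module.Dual ℂ V)) :
    ∃ e : ι → V, ∀ (φ : Module.Dual ℂ V) (i : ι), (φ (e i)).re = b'.repr φ i :=
  ⟨fun i ↦ (Module.evalEquiv ℂ V).symm (Module.Dual.extendRCLike (𝕜 := ℂ) (b'.coord i)),
    fun φ i ↦ by
      rw [Module.apply_evalEquiv_symm_apply]
      exact Module.Dual.re_extendRCLike_apply (𝕜 := ℂ) (b'.coord i) φ⟩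

section DualVectors

variable {b' : Module.Basis ι ℝ (Module.Dual ℂ V)} {e : ι → V}
  (he : ∀ (φ : Module.Dual ℂ V) (i : ι), (φ (e i)).re = b'.repr φ i)
include he

/-- `re b'ᵢ(eᵢ) = 1`. [folklore] -/
theorem re_basis_apply_self_of_re_apply_eq_repr (i : ι) : (b' i (e i)).re = 1 := by
  rw [he, b'.repr_self, Finsupp.single_eq_same]

/-- `re b'ⱼ(eᵢ) = 0` for `i ≠ j`. [folklore] -/
theorem re_basis_apply_of_ne_of_re_apply_eq_repr {i j : ι} (h : i ≠ j) : (b' j (e i)).re = 0 := by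
  classical
  rw [he, b'.repr_self, Finsupp.single_apply, if_neg h.symm]

variable [Fintype ι] [Module ℝ V] [IsScalarTower ℝ ℂ V]

/-- Every `v ∈ V` is `∑ᵢ re b'ᵢ(v) · eᵢ`. [folklore] -/
theorem eq_sum_re_smul_of_re_apply_eq_repr (v : V) : v = ∑ i, (b' i v).re • e i := by
  rw [← sub_eq_zero]
  refine eq_zero_of_forall_re_apply_eq_zero fun φ ↦ ?_
  rw [map_sub, Complex.sub_re, map_sum, Complex.re_sum, sub_eq_zero,
    re_apply_eq_sum_repr_mul b' φ v]
  refine Finset.sum_congr rfl fun i _ ↦ ?_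
  rw [re_apply_real_smul, he, mul_comm]

/-- The `eᵢ` are linearly independent over `ℝ`. [folklore] -/
theorem linearIndependent_of_re_apply_eq_repr : LinearIndependent ℝ e := by
  rw [Fintype.linearIndependent_iff]
  intro g hg j
  have h := congrArg (fun w : V ↦ (b' j w).re) hg
  simp only [map_sum, map_zero, Complex.zero_re, Complex.re_sum, re_apply_real_smul] at h
  rw [Finset.sum_eq_single j, re_basis_apply_self_of_re_apply_eq_repr he, mul_one] at h
  · exact h
  · intro i _ hij
    rw [re_basis_apply_of_ne_of_re_apply_eq_repr he hij, mul_zero]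
  · exact fun hj ↦ absurd (Finset.mem_univ j) hj

/-- The `eᵢ` span `V` over `ℝ`. [folklore] -/
theorem top_le_span_of_re_apply_eq_repr : ⊤ ≤ Submodule.span ℝ (Set.range e) := by
  rintro v -
  rw [eq_sum_re_smul_of_re_apply_eq_repr he v]
  exact Submodule.sum_mem _ fun i _ ↦ Submodule.smul_mem _ _ (Submodule.subset_span ⟨i, rfl⟩)

end DualVectors

/-- **A stable lattice from a stable dual lattice.** If `b'` is an `ℝ`-basis of the complex dual
`V^∧` of a finite-dimensional complex vector space `V` whose `ℤ`-span is mapped into itself by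
the transpose `T^∨` of every `T` in a set `S` of endomorphisms of `V`, then the dual basis `b`
(`re b'ⱼ(bᵢ) = δᵢⱼ`, `exists_forall_re_apply_eq_repr`) is an `ℝ`-basis of `V` whose `ℤ`-span is
mapped into itself by every `T ∈ S`: `T bᵢ = ∑ⱼ re((T^∨ b'ⱼ)(bᵢ)) bⱼ` and `re((T^∨ b'ⱼ)(bᵢ))` is
the `i`-th coordinate of `T^∨ b'ⱼ` in `b'`, an integer. This is the linear algebra of Shimura
1971, §8.4 (p. 241) and of the proof of Thm. 3.48 (p. 84: "`ξ` sends the lattice `L` into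
itself, so that `ρ₀(ξ) ∈ M_{2r}(ℤ)`"), read dually. [cite: Shimura1971, §8.4 p. 241] -/
theorem exists_basis_of_dual_basis [FiniteDimensional ℂ V] [Fintype ι] [Module ℝ V]
    [IsScalarTower ℝ ℂ V] (b' : Module.Basis ι ℝ (Module.Dual ℂ V))
    (S : Set (Module.End ℂ V))
    (hS : ∀ T ∈ S, ∀ j, T.dualMap (b' j) ∈ Submodule.span ℤ (Set.range b')) :
    ∃ b : Module.Basis ι ℝ V, (∀ (φ : Module.Dual ℂ V) i, (φ (b i)).re = b'.repr φ i) ∧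
      ∀ T ∈ S, ∀ i, T (b i) ∈ Submodule.span ℤ (Set.range b) := by
  obtain ⟨e, he⟩ := exists_forall_re_apply_eq_repr b'
  let b : Module.Basis ι ℝ V := Module.Basis.mk (linearIndependent_of_re_apply_eq_repr he)
    (top_le_span_of_re_apply_eq_repr he)
  have hb : ⇑b = e := Module.Basis.coe_mk _ _
  refine ⟨b, fun φ i ↦ by rw [hb, he], fun T hT i ↦ ?_⟩
  rw [hb, eq_sum_re_smul_of_re_apply_eq_repr he (T (e i))]
  refine Submodule.sum_mem _ fun j _ ↦ ?_
  -- the `i`-th coordinate of `T^∨ b'ⱼ` in the basis `b'` is an integer `m`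
  obtain ⟨m, hm⟩ := (Module.Basis.mem_span_iff_repr_mem ℤ b' (T.dualMap (b' j))).1 (hS T hT j) i
  have hre : (b' j (T (e i))).re = (m : ℝ) := by
    rw [← LinearMap.dualMap_apply, he, ← hm, eq_intCast]
  rw [hre, Int.cast_smul_eq_zsmul ℝ]
  exact zsmul_mem (Submodule.subset_span (Set.mem_range_self j) :
    e j ∈ Submodule.span ℤ (Set.range e)) m

end DualBasis

/-! ### (3.5.20) from a Hecke-stable dual lattice; weight `2`; trivial weights -/

section Gamma0

variable (N : ℕ) [NeZero N] (k : ℤ)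

/-- **(3.5.20) from a Hecke-stable integral structure on the dual.** If `S_k(Γ₀(N))^∧` has an
`ℝ`-basis whose `ℤ`-span is stable under all `T_p^∨`, `p` prime — which is how Shimura obtains
the lattice: `j(H¹_P(Γ, ℤ^{k-1}))` is a lattice in `H¹_P(Γ, ℝ^{k-1}) ≅ S_k(Γ)` (Prop. 8.6,
Thm. 8.4) stable under the double cosets (Prop. 8.5) — then `S_k(Γ₀(N))` has an `ℝ`-basis whose
`ℤ`-span is stable under all `T_p` (`exists_basis_of_dual_basis`). [cite: Shimura1971, §8.4 p. 241 (Prop. 8.6 with Thm. 8.4, Prop. 8.5)] -/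
theorem gamma0_exists_heckeStableLattice_of_dual_basis
    (H : ∃ (n : ℕ) (b' : Module.Basis (Fin n) ℝ (Module.Dual ℂ (CuspForm (Gamma0 N) k))),
      ∀ (p : ℕ) (hp : p.Prime) (j : Fin n),
        (haveI : NeZero p := ⟨hp.ne_zero⟩; (heckeT (Gamma0 N) k p).dualMap (b' j)) ∈
          Submodule.span ℤ (Set.range b')) :
    gamma0_exists_heckeStableLattice N k := by
  intro _
  obtain ⟨n, b', hb'⟩ := H
  haveI : FiniteDimensional ℂ (CuspForm (Gamma0 N) k) := finiteDimensional_cuspForm_gamma0 N k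
  obtain ⟨b, -, hb⟩ := exists_basis_of_dual_basis b'
    {T | ∃ (p : ℕ) (hp : p.Prime), T = (haveI : NeZero p := ⟨hp.ne_zero⟩; heckeT (Gamma0 N) k p)}
    (by rintro _ ⟨p, hp, rfl⟩ j; exact hb' p hp j)
  exact ⟨n, b, fun p hp i ↦ hb _ ⟨p, hp, rfl⟩ i⟩

/-- **Shimura's (3.5.20) in weight `2`, for every `N ≥ 1`**: `S₂(Γ₀(N))` has an `ℝ`-basis whose
`ℤ`-span is stable under all `T_p`, `p` prime (`U_p` for `p ∣ N` included). The dual lattice is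
the period homology `H₁(X₀(N), ℤ) ⊆ S₂(Γ₀(N))^∧`, which is the `ℤ`-span of an `ℝ`-basis of the
dual space (`periodHomology_eq_span_basis_holds`: Eichler–Shimura for `X₀(N)`) and is stable
under the `T_p^∨` (`dualMap_heckeT_mem_periodHomology`); the lattice in `S₂(Γ₀(N))` is its dual
basis (`exists_basis_of_dual_basis`). (Shimura 1971, (3.5.20), p. 84, and §8.4, p. 241, case
`n = 0`; Diamond–Shurman §6.5, p. 237: "the operators act as endomorphisms on `H₁(X₁(N), ℤ)`".)
[cite: Shimura1971, (3.5.20) p. 84 and §8.4 p. 241] -/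
theorem gamma0_exists_heckeStableLattice_two : gamma0_exists_heckeStableLattice N 2 := by
  refine gamma0_exists_heckeStableLattice_of_dual_basis N 2 ?_
  obtain ⟨n, b', hb'⟩ := periodHomology_eq_span_basis_holds N
  refine ⟨n, b', fun p hp j ↦ ?_⟩
  haveI : NeZero p := ⟨hp.ne_zero⟩
  have hj : b' j ∈ periodHomology N := by
    rw [← SetLike.mem_coe, hb']
    exact Submodule.subset_span ⟨j, rfl⟩
  have := dualMap_heckeT_mem_periodHomology N hp hj
  rw [← SetLike.mem_coe, hb'] at this
  exact this

/-- If `S_k(Γ₀(N)) = 0` then (3.5.20) holds with the empty basis. [folklore] -/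
theorem gamma0_exists_heckeStableLattice_of_forall_eq_zero (h0 : ∀ f : CuspForm (Gamma0 N) k, f = 0) :
    gamma0_exists_heckeStableLattice N k := by
  intro _
  haveI : Subsingleton (CuspForm (Gamma0 N) k) := ⟨fun f g ↦ by rw [h0 f, h0 g]⟩
  exact ⟨0, Module.Basis.empty _, fun p hp i ↦ i.elim0⟩

/-- For `k < 2` the fact (3.5.20), stated for `k ≥ 2`, holds vacuously. [folklore] -/
theorem gamma0_exists_heckeStableLattice_of_lt_two (hk : k < 2) :
    gamma0_exists_heckeStableLattice N k :=
  fun h ↦ absurd h (not_le.mpr hk)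

/-- For odd `k` there are no nonzero cusp forms on `Γ₀(N)` (`-1 ∈ Γ₀(N)`,
`eq_zero_of_odd_weight_gamma0`; Diamond–Shurman §4.3, p. 119), so (3.5.20) holds with the empty
basis. [folklore] -/
theorem gamma0_exists_heckeStableLattice_of_odd (hk : Odd k) :
    gamma0_exists_heckeStableLattice N k :=
  gamma0_exists_heckeStableLattice_of_forall_eq_zero N k (eq_zero_of_odd_weight_gamma0 N hk)

/-- **(3.5.20) for `Γ₀(N)` in every weight except possibly the even weights `k ≥ 4`**: vacuous
for `k < 2`, empty for odd `k`, and the period homology in weight `2`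
(`gamma0_exists_heckeStableLattice_two`). The remaining case is the real Eichler–Shimura
isomorphism `H¹_P(Γ₀(N), Symⁿℝ²) ≅ S_{n+2}(Γ₀(N))`, `n ≥ 2` even (Shimura 1971, Thm. 8.4 with
(8.2.23), Prop. 8.6). [cite: Shimura1971, (3.5.20) p. 84 and §8.4 p. 241] -/
theorem gamma0_exists_heckeStableLattice_of_not_even_or_lt_four (hk : ¬Even k ∨ k < 4) :
    gamma0_exists_heckeStableLattice N k := by
  rcases hk with hk | hk
  · exact gamma0_exists_heckeStableLattice_of_odd N k (Int.not_even_iff_odd.mp hk)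
  · rcases lt_or_ge k 2 with h2 | h2
    · exact gamma0_exists_heckeStableLattice_of_lt_two N k h2
    · rcases Int.even_or_odd k with he | ho
      · obtain rfl : k = 2 := by obtain ⟨m, rfl⟩ := he; omega
        exact gamma0_exists_heckeStableLattice_two N
      · exact gamma0_exists_heckeStableLattice_of_odd N k ho

end Gamma0

end Literature.NumberTheory.EllipticCurves.ModularForms
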